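import Summits.CriticalPhenomena.PercolationContinuityZ3.Theorems.PercNearOneGluingNoHeavyQuantSliceSingleLowDEC
import HarnessLib

/-!
# QUANT lane R8, T-DEC: SL-λ* FOR SINGLE-LOW LAWS in the conjecture's own form — the side conditions of the single-low slice theorems
# DERIVED from `λ* = (least charged mid compatible with the low) − 1` (LEAD-NOTES-G22 N48 (1)–(3))

builds on p205010 (kernel theorem, internal audit signed; external expert review pending)

Support file (`--supports stmt-CriticalPhenomena-4575`), QUANT lane typer seat prim-quant-stmt (gen 23), rung R8 of
`run/shared/lean/prim/quant/LADDER.md`.  Theorems only (no definitions); standard axioms, no sorries.  Wrappers of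
`slice_decAtT_singleLow_case1` / `slice_decAtT_singleLow_of_half` (…QuantSliceSingleLowDEC, p308297) in which the layer parameter is the
conjecture's `λ* = m₀ − 1`, `m₀` the LEAST charged mid compatible with the low `l` (given by hypotheses: `m₀ ≤ j′`, `T < l + m₀`, minimality
among charged compatible mids, and `j′ < m₀ + a` = "no true mid at or below `j′ − a`", the blueprint's standing assumption), and the two side
conditions of the single-low theorems are PROVED from the geometry lemma (lead g22 `deep_straddler_two_mul_gt`): no band atom lies above
`λ*`, and every charged mid `≤ λ*` is incompatible with `l`.
* **`slice_decAtT_singleLow_lamStar_of_half`** — single-low probability law, deep low, `1 − g ≤ g`: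
  `DECAtT x T j′ M ν → DECAtT x T (m₀ − 1) M ν → DECAtT x (T + ag) j′ (M + a) (slice ν a g)`.
* **`slice_decAtT_singleLow_lamStar_case1`** — the same for every gate `g ≥ x` in Case 1 (`Σ A_h ≤ g·ν l`).
* **`slice_decAtT_singleLow_noMid`** — if NO charged mid is compatible with `l`, `DECAtT x T j′ M ν` alone gives the slice (Case 1 with
  `Σ A = 0`, `λ = j′`).
So, for single-low laws in the blueprint's frame, CONJECTURE SL-λ* (N48 (2)) is a kernel theorem except in the sub-case
`g < 1/2 ∧ Σ A_h > g·ν l` (memo FOR-PROVERS-CORNER.md §3).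

[this work]; `…QuantSliceTwoRowRates` (lead g22), `…QuantSliceSingleLow(CaseTwo/DEC)` (this seat).  Nothing here is cited as a published
result.  The gluing rows served [cite: KozmaNitzan2024, Conjecture 3 (p. 15)]; product measure [cite: Grimmett1999, §1.3 p. 10].
-/

noncomputable section

namespace Summit.CriticalPhenomena.PercolationContinuityZ3.Theorems

namespace Quant

open Finset

namespace LawDec

/-- **the side conditions at `λ* = m₀ − 1`**: for a deep low `l` and the least charged compatible mid `m₀` (`T < l + m₀`, minimal), no
charged atom above `λ*` and `≤ j′` is a band atom, and every charged mid `≤ λ*` is incompatible with `l`. [this work] -/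
theorem lamStar_side_conditions (T g : ℝ) (j' l a m₀ : ℕ) (ν : ℕ → ℝ) (hg1 : g ≤ 1)
    (hdeep : 2 * ((l : ℝ) + a) < T + (a : ℝ) * g) (hm₀j : m₀ ≤ j') (hm₀c : T < (l : ℝ) + m₀)
    (hmin : ∀ m, m ≤ j' → T < (l : ℝ) + m → 0 < ν m → m₀ ≤ m) :
    (∀ h, m₀ - 1 < h → h ≤ j' → 0 < ν h → T + (a : ℝ) * g ≤ 2 * (h : ℝ)) ∧
      (∀ h, h ≤ m₀ - 1 → T ≤ 2 * (h : ℝ) → 0 < ν h → (l : ℝ) + h ≤ T) := by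
  have hm₀ := deep_straddler_two_mul_gt T g l m₀ a hg1 hdeep hm₀c
  have hm₀pos : 0 < m₀ := by
    have := deep_lt_mid T g l m₀ a hdeep hm₀.le; omega
  refine ⟨fun h hlt _ _ => ?_, fun h hle _ hνh => ?_⟩
  · have hmh : m₀ ≤ h := by omega
    have : (m₀ : ℝ) ≤ h := by exact_mod_cast hmh
    linarith
  · by_contra hn
    push Not at hn
    have hhj : h ≤ j' := by omega
    have := hmin h hhj hn hνh
    omega

/-- **SL-λ* FOR SINGLE-LOW LAWS, `g ≥ 1/2`** (N48 (2) for single-low laws; both cases of N48 (3) with `1 − g ≤ g`).  Frame: probability law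
`ν` on `{0..M}`; `l` its only low at `(T, j′)`, deep, `l + a ≤ j′ ≤ M`; `m₀` the least charged mid compatible with `l`, above `j′ − a`;
blob `(a ≥ 1, x ≤ g ≤ 1, 1 − g ≤ g)`.  Then `DEC(T, j′) ∧ DEC(T, m₀ − 1) ⟹ DEC(T + ag, j′)` for the slice. [this work] -/
theorem slice_decAtT_singleLow_lamStar_of_half (x T g : ℝ) (j' M l a m₀ : ℕ) (ν : ℕ → ℝ) (hx0 : 0 < x) (hx1 : x < 1)
    (hxg : x ≤ g) (hg1 : g ≤ 1) (hhalf : 1 - g ≤ g) (ha : 1 ≤ a) (hν : ∀ k, 0 ≤ ν k) (hνM : ∀ k, M < k → ν k = 0)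
    (hν1 : ∑ h ∈ Finset.range (M + 1), ν h = 1) (hjM : j' ≤ M) (hlaj : l + a ≤ j') (hlow : 2 * (l : ℝ) < T)
    (hdeep : 2 * ((l : ℝ) + a) < T + (a : ℝ) * g) (hsingle : ∀ k, k ≤ j' → 2 * (k : ℝ) < T → k ≠ l → ν k = 0)
    (hm₀j : m₀ ≤ j') (hm₀c : T < (l : ℝ) + m₀) (hm₀a : j' < m₀ + a)
    (hmin : ∀ m, m ≤ j' → T < (l : ℝ) + m → 0 < ν m → m₀ ≤ m)
    (hdecj : DECAtT x T j' M ν) (hdeclam : DECAtT x T (m₀ - 1) M ν) :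
    DECAtT x (T + (a : ℝ) * g) j' (M + a) (slice ν a g) := by
  obtain ⟨hnoband, hincomp⟩ := lamStar_side_conditions T g j' l a m₀ ν hg1 hdeep hm₀j hm₀c hmin
  exact slice_decAtT_singleLow_of_half x T g j' M l a (m₀ - 1) ν hx0 hx1 hxg hg1 ha hν hνM hν1 hjM hlaj hlow hdeep hsingle
    (by omega) (by omega) hnoband hincomp hdecj hdeclam hhalf

/-- **SL-λ* FOR SINGLE-LOW LAWS, CASE 1** (every gate `x ≤ g ≤ 1`; `Σ_h A_h ≤ g·ν l`). [this work] -/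
theorem slice_decAtT_singleLow_lamStar_case1 (x T g : ℝ) (j' M l a m₀ : ℕ) (ν : ℕ → ℝ) (hx0 : 0 < x) (hx1 : x < 1)
    (hxg : x ≤ g) (hg1 : g ≤ 1) (ha : 1 ≤ a) (hν : ∀ k, 0 ≤ ν k) (hνM : ∀ k, M < k → ν k = 0)
    (hν1 : ∑ h ∈ Finset.range (M + 1), ν h = 1) (hjM : j' ≤ M) (hlaj : l + a ≤ j') (hlow : 2 * (l : ℝ) < T)
    (hdeep : 2 * ((l : ℝ) + a) < T + (a : ℝ) * g) (hsingle : ∀ k, k ≤ j' → 2 * (k : ℝ) < T → k ≠ l → ν k = 0)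
    (hm₀j : m₀ ≤ j') (hm₀c : T < (l : ℝ) + m₀) (hm₀a : j' < m₀ + a)
    (hmin : ∀ m, m ≤ j' → T < (l : ℝ) + m → 0 < ν m → m₀ ≤ m)
    (hdecj : DECAtT x T j' M ν) (hdeclam : DECAtT x T (m₀ - 1) M ν)
    (hcase1 : ∑ h ∈ Finset.range (M + a + 1),
        (if h ≤ j' ∧ T ≤ 2 * (h : ℝ) ∧ T < (l : ℝ) + h then (1 - g) * ν h / usage x (T + (a : ℝ) * g) j' (l + a) h else 0)
      ≤ g * ν l) :
    DECAtT x (T + (a : ℝ) * g) j' (M + a) (slice ν a g) := by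
  obtain ⟨hnoband, hincomp⟩ := lamStar_side_conditions T g j' l a m₀ ν hg1 hdeep hm₀j hm₀c hmin
  exact slice_decAtT_singleLow_case1 x T g j' M l a (m₀ - 1) ν hx0 hx1 hxg hg1 ha hν hνM hν1 hjM hlaj hlow hdeep hsingle
    (by omega) (by omega) hnoband hincomp hdecj hdeclam hcase1

/-- **no charged mid compatible with the low**: then DEC(j′) alone slices (Case 1 with no anti-diagonal capacity, `λ = j′`). [this work] -/
theorem slice_decAtT_singleLow_noMid (x T g : ℝ) (j' M l a : ℕ) (ν : ℕ → ℝ) (hx0 : 0 < x) (hx1 : x < 1)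
    (hxg : x ≤ g) (hg1 : g ≤ 1) (ha : 1 ≤ a) (hν : ∀ k, 0 ≤ ν k) (hνM : ∀ k, M < k → ν k = 0)
    (hν1 : ∑ h ∈ Finset.range (M + 1), ν h = 1) (hjM : j' ≤ M) (hlaj : l + a ≤ j') (hlow : 2 * (l : ℝ) < T)
    (hdeep : 2 * ((l : ℝ) + a) < T + (a : ℝ) * g) (hsingle : ∀ k, k ≤ j' → 2 * (k : ℝ) < T → k ≠ l → ν k = 0)
    (hnone : ∀ m, m ≤ j' → T < (l : ℝ) + m → ν m = 0) (hdecj : DECAtT x T j' M ν) :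
    DECAtT x (T + (a : ℝ) * g) j' (M + a) (slice ν a g) := by
  have hg0 : 0 ≤ g := hx0.le.trans hxg
  refine slice_decAtT_singleLow_case1 x T g j' M l a j' ν hx0 hx1 hxg hg1 ha hν hνM hν1 hjM hlaj hlow hdeep hsingle
    (by omega) le_rfl (fun h h1 h2 _ => absurd h2 (by omega)) (fun h hhj _ hνh => ?_) hdecj hdecj ?_
  · by_contra hn
    push Not at hn
    exact absurd (hnone h hhj hn) hνh.ne'
  · have hz : ∀ h ∈ Finset.range (M + a + 1),
        (if h ≤ j' ∧ T ≤ 2 * (h : ℝ) ∧ T < (l : ℝ) + h then (1 - g) * ν h / usage x (T + (a : ℝ) * g) j' (l + a) h else 0) = 0 := by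
      intro h _
      split_ifs with hc
      · rw [hnone h hc.1 hc.2.2]; simp
      · rfl
    rw [Finset.sum_congr rfl hz, Finset.sum_const_zero]
    exact mul_nonneg hg0 (hν l)

end LawDec

end Quant

end Summit.CriticalPhenomena.PercolationContinuityZ3.Theorems
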